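import Summits.BirchSwinnertonDyer.BirchSwinnertonDyer.Theorems.RamifiedSevenEllipticUnitsStrictControlAnyPrime
import Summits.BirchSwinnertonDyer.BirchSwinnertonDyer.Theorems.RamifiedSevenEllipticUnitsIndexIffControl
import Literature.NumberTheory.EllipticCurves.Wuthrich2014.ShaBoundProofs
import Literature.NumberTheory.EllipticCurves.AnalyticRankOrderProofs
import HarnessLib

set_option linter.dupNamespace false

/-!
# Route `RamifiedSevenEllipticUnits` (rung K7r): the O11 corner at EVERY CM-ramified prime IS the
# elliptic-unit index law (R-EU) — `X12.O11.RamifiedCMEllipticUnitIndexAt W p ↔ BSDp W p` for every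
# CM curve of analytic rank one at its ramified prime, class-free, modulo four named facts

Cell `bsd-cm`, seat `bsd-cm-k7r-c4` (g4). HONEST FRAMING: nothing here closes a route item and BSD is
not proved by any of this; a closed item closes a rung leaf of BirchSwinnertonDyer at most. This is
frame-level content of the K7r typed objects BEYOND the class 𝒞₇ / the prime `7`, companion of
`…StrictControlAnyPrime` ((R-ctrl) unconditional, (R-tors) ⟸ GZK, at every frame). Here the FRAME
DATA are constructed at every CM-ramified prime (k7r's `frameDataSeven_of_GZK` typed them at `7` on
𝒞₇ only) and the O11 consumer is closed in both directions, so that for EVERY globally minimal CM curve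
`W/ℚ` of analytic rank one and its CM-ramified prime `p ≥ 5` (then `p = |d_K| ∈ {7, 11, 19, 43, 67,
163}`; no condition on the other bad primes, no condition at `2`):

  (R-EU)@`p` at `W`  ⟺  Miller's `BSD(W, p)`,   modulo {modularity, GZ I.(7.3), GZK, Cassels}.

So the census cells of CornerF-ramified (B13/O11) at `p ≥ 5` carry exactly ONE residual statement each,
the elliptic-unit index law (R-EU) = Perrin-Riou's conjecture for the CM zeta element at `p = |d_K|`
(BKNO 2026 §1.4 "report elsewhere"): CONSTRUCTION / OPEN, nothing asserted about it here. k7r-c2's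
`ellipticUnitIndexAt_seven_iff_bsdp` (p431947) is the case `p = 7`, `W ∈ 𝒞₇`.

## Main statements

* `exists_isFrame_of_cmRamified` — an O11 frame `(K, 𝔭, W', C)` EXISTS at every `(W, p)` with `W` CM
  globally minimal and `p ≥ 5` CM-ramified (the field `ℚ(√−p)`, a prime above `p`, a globally minimal
  model of `W^{(−p)}`); unconditional.
* `exists_frameData_of_GZK` — the full frame data (frame, isogeny `W ∼ W'`, anticyclotomic
  `ℤ_p`-extension with topological generator, generators of `W(ℚ)`, `W'(ℚ)` modulo torsion with their
  `p`-divisibility levels, `E(ℚ_p)[p] = 0` for both) at analytic rank one, CONDITIONAL on GZK only.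
* `bsdp_of_ramifiedCMEllipticUnitIndexAt_of_analyticRank_eq_one` — (R-EU)@`p` ⟹ `BSD(W, p)`.
* `ramifiedCMEllipticUnitIndexAt_of_bsdp` — `BSD(W, p)` ⟹ (R-EU)@`p` (analytic rank `≤ 1`).
* **`ramifiedCMEllipticUnitIndexAt_iff_bsdp`** — the equivalence at analytic rank one.

References: [BurungaleKobayashiNakamuraOta2026] §1.4, Thm. 7.2 (arXiv:2608.06879; shape only — nothing
of it is used); [Miller2011LMS] Def. 1.1; [Cassels1965ArithmeticVIII]; [GrossZagier1986] I.(7.3);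
[Darmon2004] Thm. 3.22 (GZK); [SilvermanATAEC1994] App. A §3; [Washington1997] Thm. 13.4.
-/

noncomputable section

open scoped Classical

open WeierstrassCurve NumberField IsDedekindDomain Field
  Literature.NumberTheory.EllipticCurves
  Literature.NumberTheory.EllipticCurves.Rank1Residual
  Literature.NumberTheory.GaloisRepresentations
  Summit.BirchSwinnertonDyer.Rank1Residual
  Summit.BirchSwinnertonDyer.Rank1Residual.X12.O11

namespace Summit.BirchSwinnertonDyer.BirchSwinnertonDyer.Theorems.RamifiedSevenEllipticUnits

/-! ## §1 Frames exist at every CM-ramified prime -/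

/-- **An O11 frame exists at every `(W, p)` with `W` CM globally minimal and `p ≥ 5` CM-ramified.**
Then `d_K = −p`, `p ≡ 3 (mod 4)` (`X12.eq_of_dvd_cmFieldDiscrOfJ`); `K = ℚ(√−p)` is the quadratic field
of fundamental discriminant `−p` (`Quadratic.exists_numberField_discr_eq`), imaginary as `d_K < 0`;
`𝔭 ∋ p` exists; the twin is a globally minimal model of `W^{(−p)}` (`hasGlobalMinimalModel_rat_holds`).
[cite: SilvermanATAEC1994, App. A §3 (table of CM j-invariants)] [cite: SilvermanAEC2009, Cor. VIII.8.3 (global minimal models over ℚ)] -/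
theorem exists_isFrame_of_cmRamified (W : WeierstrassCurve ℚ) [W.IsElliptic] [W.IsGloballyMinimal]
    (p : ℕ) [Fact p.Prime] (hCM : W.HasCM) (hram : CMRamified W p) (h5 : 5 ≤ p) :
    ∃ (K : Type) (_ : Field K) (_ : NumberField K) (𝔭 : HeightOneSpectrum (𝓞 K))
      (W' : WeierstrassCurve ℚ) (_ : W'.IsElliptic) (_ : W'.IsGloballyMinimal) (C : VariableChange ℚ),
      IsFrame W p K 𝔭 W' C := by
  have hp : p.Prime := Fact.out
  have hd : cmFieldDiscrOfJ W.j = -(p : ℤ) := X12.cmFieldDiscrOfJ_eq_neg_of_dvd W hCM hp h5 hram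
  have hp4 : p % 4 = 3 := X12.mod_four_eq_three_of_dvd_cmFieldDiscrOfJ W hCM hp h5 hram
  -- the CM field `K = ℚ(√−p)` and a prime above `p`
  obtain ⟨K, _, _, h2, hdK⟩ :=
    Literature.NumberTheory.QuadraticFields.Quadratic.exists_numberField_discr_eq (D := -(p : ℤ))
      (Or.inl ⟨by omega, by
        rw [← Int.squarefree_natAbs, Int.natAbs_neg, Int.natAbs_natCast]
        exact (Nat.prime_iff.mp hp).squarefree, by omega⟩)
  have hK : IsImaginaryQuadratic K :=
    isImaginaryQuadratic_iff_discr_neg.mpr ⟨h2, by rw [hdK]; have := hp.pos; omega⟩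
  obtain ⟨𝔭, h𝔭⟩ :=
    Literature.NumberTheory.Automorphic.PatchingFamily.exists_heightOneSpectrum_natCast_mem K hp
  -- the frame twin
  have hd0 : ((cmFieldDiscrOfJ W.j : ℤ) : ℚ) ≠ 0 := by
    rw [hd]; push_cast; exact neg_ne_zero.mpr (Nat.cast_ne_zero.mpr hp.ne_zero)
  haveI := W.isElliptic_quadraticTwist hd0
  obtain ⟨C, hC⟩ := hasGlobalMinimalModel_rat_holds (W.quadraticTwist ((cmFieldDiscrOfJ W.j : ℤ) : ℚ))
  haveI := hC
  exact ⟨K, inferInstance, inferInstance, 𝔭, C • W.quadraticTwist ((cmFieldDiscrOfJ W.j : ℤ) : ℚ),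
    inferInstance, hC, C, hCM, hram, h5, hK, by rw [hdK, hd], h𝔭, rfl⟩

/-! ## §2 The frame data at analytic rank one, from Gross–Zagier–Kolyvagin -/

/-- **Frame data at every CM-ramified prime, granted GZK.** For `W/ℚ` globally minimal with CM,
`p ≥ 5` CM-ramified and `r_an(W) = 1`: a frame `(K, 𝔭, W', C)` (§1) with `W ∼ W'`
(`isIsogenous_of_isFrame`), an anticyclotomic `ℤ_p`-extension of `K`
(`ZpExtension.exists_isAnticyclotomic_holds`, unconditional in the tree) with a topological generator,
and for `W` and `W'` a generator of the Mordell–Weil group modulo torsion with its exact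
`p`-divisibility level in `E(ℚ_p)` (`exists_generator_with_level`; rank one for `W'` by isogeny
invariance of the analytic rank) and `E(ℚ_p)[p] = 0` (`prime_nsmul_eq_zero_padic_of_hasCM_of_cmRamified`;
`W'` has CM with the same `d_K`). The ONLY non-constructive input is `rank_ℤ = r_an = 1` (GZK, `hGZK`).
This is the body of the route's `FrameDataSeven` (k7r `frameDataSeven_of_GZK`) with `7 ↦ p` and the
class 𝒞₇ replaced by "CM, `p` ramified". [cite: Darmon2004, Thm. 3.22 (= Thm. 1.14) and §3.9]
[cite: SilvermanAEC2009, Prop. VII.6.3 and Thm. VIII.6.7] [cite: Washington1997, Thm. 13.4] -/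
theorem exists_frameData_of_GZK (hGZK : rank_eq_analyticRank_of_analyticRank_le_one)
    (W : WeierstrassCurve ℚ) [W.IsElliptic] [W.IsGloballyMinimal] (p : ℕ) [Fact p.Prime]
    (hCM : W.HasCM) (hram : CMRamified W p) (h5 : 5 ≤ p) (hr : W.analyticRank = 1) :
    ∃ (K : Type) (_ : Field K) (_ : NumberField K) (𝔭 : HeightOneSpectrum (𝓞 K))
      (W' : WeierstrassCurve ℚ) (_ : W'.IsElliptic) (_ : W'.IsGloballyMinimal) (C : VariableChange ℚ)
      (κ : ZpExtension K p) (γ : absoluteGaloisGroup K) (_ : Fact (κ.IsTopGenerator γ))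
      (P : W.toAffine.Point) (n : ℕ) (P' : W'.toAffine.Point) (n' : ℕ),
      IsFrame W p K 𝔭 W' C ∧ IsIsogenous W W' ∧ κ.IsAnticyclotomic ∧ ¬ IsOfFinAddOrder P ∧
      (∀ R : W.toAffine.Point, ∃ (k : ℤ) (T : W.toAffine.Point), IsOfFinAddOrder T ∧ R = k • P + T) ∧
      (∀ Q : (W.baseChange ℚ_[p]).toAffine.Point, p • Q = 0 → Q = 0) ∧
      (∃ Q : (W.baseChange ℚ_[p]).toAffine.Point, p ^ n • Q = W.toPadicPoint p P) ∧
      (∀ Q : (W.baseChange ℚ_[p]).toAffine.Point, p ^ (n + 1) • Q ≠ W.toPadicPoint p P) ∧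
      ¬ IsOfFinAddOrder P' ∧
      (∀ R : W'.toAffine.Point, ∃ (k : ℤ) (T : W'.toAffine.Point),
        IsOfFinAddOrder T ∧ R = k • P' + T) ∧
      (∀ Q : (W'.baseChange ℚ_[p]).toAffine.Point, p • Q = 0 → Q = 0) ∧
      (∃ Q : (W'.baseChange ℚ_[p]).toAffine.Point, p ^ n' • Q = W'.toPadicPoint p P') ∧
      (∀ Q : (W'.baseChange ℚ_[p]).toAffine.Point, p ^ (n' + 1) • Q ≠ W'.toPadicPoint p P') := by
  obtain ⟨K, _, _, 𝔭, W', _, _, C, hF⟩ := exists_isFrame_of_cmRamified W p hCM hram h5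
  have hK : IsImaginaryQuadratic K := hF.2.2.2.1
  have hiso : IsIsogenous W W' := isIsogenous_of_isFrame hF
  -- the anticyclotomic `ℤ_p`-extension and a topological generator
  obtain ⟨κ, hκ⟩ := ZpExtension.exists_isAnticyclotomic_holds (K := K) (p := p) hK.1
    (fun w => hK.2.isComplex w)
  obtain ⟨γ, hγ⟩ := κ.exists_isTopGenerator
  -- Mordell–Weil data and levels for `W` and `W'` (GZK gives rank one)
  have hrank : W.mordellWeilRank = 1 := by rw [(hGZK W hr.le).1, hr]
  have hr' : W'.analyticRank = 1 := by rw [← analyticRank_eq_of_isIsogenous' hiso, hr]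
  have hrank' : W'.mordellWeilRank = 1 := by rw [(hGZK W' hr'.le).1, hr']
  obtain ⟨P, n, hP, hgen, hdiv, hndiv⟩ := exists_generator_with_level W p hrank
  obtain ⟨P', n', hP', hgen', hdiv', hndiv'⟩ := exists_generator_with_level W' p hrank'
  -- no `p`-torsion in `E(ℚ_p)` for `W` and `W'`
  have hCM' : W'.HasCM := X12.hasCM_of_isIsogenous hiso hCM
  have hram' : CMRamified W' p := by
    change (p : ℤ) ∣ cmFieldDiscrOfJ W'.j
    rw [← X12.cmFieldDiscrOfJ_eq_of_isIsogenous hiso hCM]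
    exact hram
  exact ⟨K, inferInstance, inferInstance, 𝔭, W', inferInstance, inferInstance, C, κ, γ, ⟨hγ⟩, P, n,
    P', n', hF, hiso, hκ, hP, hgen, prime_nsmul_eq_zero_padic_of_hasCM_of_cmRamified W p hCM h5 hram,
    hdiv, hndiv, hP', hgen', prime_nsmul_eq_zero_padic_of_hasCM_of_cmRamified W' p hCM' h5 hram',
    hdiv', hndiv'⟩

/-! ## §3 (R-EU)@`p` ⟹ `BSD(W, p)` at analytic rank one, every CM-ramified prime -/

variable {W : WeierstrassCurve ℚ} [W.IsElliptic] [W.IsGloballyMinimal] {p : ℕ} [Fact p.Prime]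

/-- **(R-EU)@`p` at `W` ⟹ `BSD(W, p)`**, for every globally minimal CM curve `W/ℚ` of analytic rank
one and its CM-ramified prime `p ≥ 5`, granted modularity (`hmod`), Gross–Zagier I.(7.3) (`hGZ`), GZK
(`hGZK`) and Cassels (`hCassels`): the frame data of §2 fed to `bsdp_of_ramifiedCMEllipticUnitIndexAt`
(`O11.bsdp_of_halves` with (R-tors) ⟸ GZK and (R-ctrl) unconditional). No class clause: every bad
prime `ℓ ≠ p` and every reduction type at `2` is allowed. [cite: Miller2011LMS, §1 and Def. 1.1 (arXiv:1010.2431 p. 3)]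
[cite: GrossZagier1986, Thm. I.(7.3)] [cite: Cassels1965ArithmeticVIII] -/
theorem bsdp_of_ramifiedCMEllipticUnitIndexAt_of_analyticRank_eq_one (hmod : hasEntireLFunction_rat)
    (hGZ : GrossZagier1986_thm_I_7_3) (hGZK : rank_eq_analyticRank_of_analyticRank_le_one)
    (hCassels : bsdRHS_eq_of_isIsogenous) (hCM : W.HasCM) (hram : CMRamified W p) (h5 : 5 ≤ p)
    (hr : W.analyticRank = 1) (h3 : RamifiedCMEllipticUnitIndexAt W p) : BSDp W p := by
  obtain ⟨K, _, _, 𝔭, W', _, _, C, κ, γ, _, P, n, P', n', hF, -, hκ, hP, hgen, htors, hdiv, hndiv,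
    hP', hgen', htors', hdiv', hndiv'⟩ := exists_frameData_of_GZK hGZK W p hCM hram h5 hr
  exact bsdp_of_ramifiedCMEllipticUnitIndexAt hmod hGZ hGZK hCassels h3 hF hr hκ γ hP hgen htors hdiv
    hndiv hP' hgen' htors' hdiv' hndiv'

/-! ## §4 `BSD(W, p)` ⟹ (R-EU)@`p`, every prime -/

/-- **`BSD(W, p)` ⟹ (R-EU)@`p` at `W`** for every globally minimal `W/ℚ` of analytic rank `≤ 1` and
every prime `p`, granted Cassels (`hCassels`), modularity (`hmod`, for `L^{(r)}(E,1)/r! ≠ 0`) and GZK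
(`hGZK`, for `Ш(W)` finite): `BSD(·, p)` is then an isogeny invariant (`Wuthrich2014.bsdp_of_isIsogenous`),
and (R-ctrl) is a theorem (`ramifiedCMStrictControlAt_holds`), so k7r-c2's
`ellipticUnitIndexAt_of_strictControlAt_of_bsdp_isogenyClass` (p409726) applies. The statement is
vacuous unless `W` has CM with `d_K = −p`. [cite: Cassels1965ArithmeticVIII]
[cite: Miller2011LMS, Def. 1.1 (arXiv:1010.2431 p. 3)] -/
theorem ramifiedCMEllipticUnitIndexAt_of_bsdp (hCassels : bsdRHS_eq_of_isIsogenous)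
    (hmod : hasEntireLFunction_rat) (hGZK : rank_eq_analyticRank_of_analyticRank_le_one)
    (hr : W.analyticRank ≤ 1) (hB : BSDp W p) : RamifiedCMEllipticUnitIndexAt W p := by
  have hfin : Finite W.sha := (hGZK W hr).2
  have hlead : W.leadingLCoeff ≠ 0 := WeierstrassCurve.leadingLCoeff_ne_zero_holds (hmod W)
  exact ellipticUnitIndexAt_of_strictControlAt_of_bsdp_isogenyClass (ramifiedCMStrictControlAt_holds W p)
    fun V _ _ hiso => Wuthrich2014.bsdp_of_isIsogenous hCassels hiso.symm_of_charZero hfin hlead hB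

/-! ## §5 The O11 corner at every ramified prime is (R-EU) -/

/-- **(R-EU)@`p` at `W` ⟺ `BSD(W, p)`** for every globally minimal CM curve `W/ℚ` of analytic rank one
and its CM-ramified prime `p ≥ 5` (`p = |d_K| ∈ {7, 11, 19, 43, 67, 163}`), modulo exactly modularity,
Gross–Zagier I.(7.3), GZK and Cassels. No condition on the other bad primes or at `2`: the O11 census
cells at `p ≥ 5` each carry ONE residual statement, the elliptic-unit index law (R-EU) (Perrin-Riou's
conjecture for the CM zeta element at the ramified prime; BKNO 2026 §1.4 "report elsewhere"),
CONSTRUCTION / OPEN — nothing is asserted about it. k7r-c2's `ellipticUnitIndexAt_seven_iff_bsdp` is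
the case `p = 7`, `W ∈ 𝒞₇`. [cite: Miller2011LMS, §1 and Def. 1.1 (arXiv:1010.2431 p. 3)]
[cite: BurungaleKobayashiNakamuraOta2026, §1.4 and Thm. 7.2 (arXiv:2608.06879 pp. 8, 40) (claim; preprint; shape only)] -/
theorem ramifiedCMEllipticUnitIndexAt_iff_bsdp (hmod : hasEntireLFunction_rat)
    (hGZ : GrossZagier1986_thm_I_7_3) (hGZK : rank_eq_analyticRank_of_analyticRank_le_one)
    (hCassels : bsdRHS_eq_of_isIsogenous) (hCM : W.HasCM) (hram : CMRamified W p) (h5 : 5 ≤ p)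
    (hr : W.analyticRank = 1) : RamifiedCMEllipticUnitIndexAt W p ↔ BSDp W p :=
  ⟨bsdp_of_ramifiedCMEllipticUnitIndexAt_of_analyticRank_eq_one hmod hGZ hGZK hCassels hCM hram h5 hr,
    ramifiedCMEllipticUnitIndexAt_of_bsdp hCassels hmod hGZK hr.le⟩

/-- **Corner form.** Granted the four named facts: for every prime `p` and every globally minimal CM
curve `W/ℚ` of analytic rank one with `p ≥ 5` CM-ramified, `BSD(W, p)` holds iff (R-EU)@`p` holds at
`W` — CornerF-ramified at `p ≥ 5` = {(R-EU)@`p`}, curve by curve. (At `p = 3`, `j = 0`, the corner is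
a different object and is not addressed.) [cite: Miller2011LMS, §1 and Def. 1.1 (arXiv:1010.2431 p. 3)] -/
theorem forall_bsdp_iff_ramifiedCMEllipticUnitIndexAt (hmod : hasEntireLFunction_rat)
    (hGZ : GrossZagier1986_thm_I_7_3) (hGZK : rank_eq_analyticRank_of_analyticRank_le_one)
    (hCassels : bsdRHS_eq_of_isIsogenous) :
    ∀ (p : ℕ) [Fact p.Prime] (W : WeierstrassCurve ℚ) [W.IsElliptic] [W.IsGloballyMinimal],
      W.HasCM → CMRamified W p → 5 ≤ p → W.analyticRank = 1 →
        (BSDp W p ↔ RamifiedCMEllipticUnitIndexAt W p) :=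
  fun _ _ _ _ _ hCM hram h5 hr ↦
    (ramifiedCMEllipticUnitIndexAt_iff_bsdp hmod hGZ hGZK hCassels hCM hram h5 hr).symm

end Summit.BirchSwinnertonDyer.BirchSwinnertonDyer.Theorems.RamifiedSevenEllipticUnits

end
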